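import Summits.AtomisticToContinuum.HydrodynamicLimit.Theorems.StiffCollisionalRelaxationAprioriBoundsFibrePartOnePrime
import HarnessLib

/-!
# Component (i) of the a-priori crux from the in-probability occupation profile and far tails in the mean
(stub `stub_partOne_of_occupation`)

Supporting file of the line `meso-chebyshev-window` for the crux `AprioriBounds`
(stmt-AtomisticToContinuum-14827; `StiffCollisionalRelaxation.AprioriBounds` =
`CollisionIsometryCLT.AprioriBoundsPreShock`), lead prover `prover-line-stmt-AtomisticToContinuum-14827-a2-0`.
It proves the registered stub `stub_partOne_of_occupation` (byte-identical to stub 5 of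
`Lines/tail_occupation_variance.lean` and of `Lines/local_units_on_the_kinetic_box.lean`): for `0 < σ ≤ 1/2`,
nice profiles and `t > 0`, (H1) the IN-PROBABILITY occupation profile `∃ Θ > 0, A, ∀ K, ∀ η > 0,
P_N{tAe^{−K/(2Θ)} + η < occ_K} → 0` (`occ_K(z) = (∫⁻₀ᵗ frac_K(Φ_s z) ds).toReal`) and (H2) `FarTailAllAt` (`Θ', A'`:
`E_N ∫₀ᵗ frac_K(s) ds ≤ tA'e^{−K/(2Θ')}` for all `K`, eventually) give component (i) of the crux VERBATIM (`PartOneAt`):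
`∃ λ > 0, C` with `P_N{C < ∫₀ᵗ (N+1)⁻¹∑ᵢ e^{λ|vᵢ(s)|²} ds} → 0`.

## Proof (layer cake + fixed level cut; bottom levels OFF the occupation events, top levels by Markov)

The λ-dial of the landed template `FibreDeficitTransfer.stub_partOnePrime` (`…FibrePartOnePrime(A).lean`) with ONE
change: there the bottom levels `K < M` are controlled by time-integrated per-time bad events inside the Markov
expectation; here they are controlled SURELY off the `M` occupation events `Bad_K = {tA⁺e^{−K/(2Θ)} + η₁ < occ_K}`, whose
probabilities tend to `0` at each fixed `K` by (H1) (monotonicity `A ≤ A⁺ := max A 0`).  Dial `λ` (`pp_exists_dial`: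
`λ < 1/(2Θ)`, `λ < 1/(2Θ')`), `ρ = e^{−(1/(2Θ') − λ)}`, `C_λ := A⁺e^{λ}/(1 − e^{−(1/(2Θ) − λ)})`, threshold `C := t·C_λ + 1`.
On a good orbit (`occ_lintegral_orbit_expAvg_le`: the layer cake `pp_ofReal_expAvg_le_tsum` integrated in time, split
at `M`) `∫₀ᵗ (N+1)⁻¹∑ᵢ e^{λ|vᵢ(s)|²} ds ≤ ∑_{K<M} e^{λ(K+1)} occ_K + R`, `R = ∑_j e^{λ(j+M+1)} occ_{j+M}`; off `⋃_{K<M} Bad_K`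
the bulk is `≤ tA⁺∑_{K<M}e^{λ(K+1)}e^{−K/(2Θ)} + η₁S₁ ≤ t·C_λ + 1/2` (`pp_sum_range_exp_mul_exp_neg_le`, `S₁ = ∑_{K<M}e^{λ(K+1)}`,
`η₁ := 1/(2S₁ + 2)`), so the bad event forces `1/2 ≤ R`; Markov and Tonelli (`AdiabatCeiling.aemeasurable_comp_flow_prod₂`)
with (H2) give `E R ≤ tA'⁺e^{λ}ρ^M/(1 − ρ)` (`occupation_markov_step`, `occupation_bound_at`).  So
`P_N(bad) ≤ ∑_{K<M} P_N(Bad_K) + 2tA'⁺e^{λ}ρ^M/(1 − ρ)`: given `η > 0` fix `M` with the second term `< η/2`, then for `N`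
large (H1 at the `M` levels, H2) `P_N(bad) ≤ η` (`ENNReal.tendsto_nhds_zero`).

No new definitions, no named facts; axioms `propext`, `Classical.choice`, `Quot.sound`.
-/

noncomputable section

open MeasureTheory ProbabilityTheory Filter Set Topology
open scoped ENNReal

namespace Summit.AtomisticToContinuum.HydrodynamicLimit.Theorems.MesoChebyshevWindow

open Literature.MathematicalPhysics.KineticTheory Literature.Analysis.FluidPDE
open Summit.AtomisticToContinuum.HydrodynamicLimit.Theorems.AprioriBoundsNegative (PartOneAt PartTwoAt)
open Summit.AtomisticToContinuum.HydrodynamicLimit.Theorems.VisitLedgerUpscattering (Cfg Flow Flows NiceProfiles)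
open Summit.AtomisticToContinuum.HydrodynamicLimit.Theorems.FibreDeficitTransfer
open Summit.AtomisticToContinuum.HydrodynamicLimit.Theorems.AdiabatCeiling (aemeasurable_comp_flow_prod₂)

/-! ## The orbit inequality (layer cake integrated in time, split at `M`, no thresholds) -/

-- adapted from …FibrePartOnePrimeA.lean (`pp_lintegral_orbit_expAvg_le`, steps (1)–(2))
/-- **Layer cake along a good orbit, split at level `M`.**  For a hard-sphere flow `Φ`, a good `z`, `λ ≥ 0`, any `t`
and `M`: `∫₀ᵗ (N+1)⁻¹∑ᵢ e^{λ|vᵢ(s)|²} ds ≤ ∑_{K<M} e^{λ(K+1)} ∫₀ᵗ frac_K(Φ_s z) ds + ∑_j e^{λ(j+M+1)} ∫₀ᵗ frac_{j+M}(Φ_s z) ds`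
(lower Lebesgue integrals; the orbit is measurable in time). -/
theorem occ_lintegral_orbit_expAvg_le {N : ℕ} {ε : ℝ} (Φ : HardSphereFlow (Torus.geometry (Fin 3)) ε (N + 1))
    {z : Cfg N} (hz : z ∈ Φ.good) {lam : ℝ} (hlam : 0 ≤ lam) (t : ℝ) (M : ℕ) :
    ∫⁻ s in Icc 0 t, ENNReal.ofReal (((N + 1 : ℕ) : ℝ)⁻¹ * ∑ i, Real.exp (lam * ‖(Φ.flow s z i).2‖ ^ 2)) ≤
      (∑ K ∈ Finset.range M, ENNReal.ofReal (Real.exp (lam * ((K : ℝ) + 1))) *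
          ∫⁻ s in Icc 0 t, ENNReal.ofReal (frac (K : ℝ) (Φ.flow s z))) +
      ∑' j : ℕ, ENNReal.ofReal (Real.exp (lam * (((j + M : ℕ) : ℝ) + 1))) *
          ∫⁻ s in Icc 0 t, ENNReal.ofReal (frac ((j + M : ℕ) : ℝ) (Φ.flow s z)) := by
  set ν : Measure ℝ := volume.restrict (Icc 0 t) with hν
  have horb : Measurable fun s => Φ.flow s z := (Φ.isTrajectory z hz).measurable_torus
  set c : ℕ → ℝ≥0∞ := fun K => ENNReal.ofReal (Real.exp (lam * ((K : ℝ) + 1))) with hc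
  set I : ℕ → ℝ≥0∞ := fun K => ∫⁻ s, ENNReal.ofReal (frac (K : ℝ) (Φ.flow s z)) ∂ν with hI
  have hfm : ∀ K : ℕ, Measurable fun s => ENNReal.ofReal (frac (K : ℝ) (Φ.flow s z)) := fun K =>
    ((measurable_frac (K : ℝ)).comp horb).ennreal_ofReal
  calc ∫⁻ s, ENNReal.ofReal (((N + 1 : ℕ) : ℝ)⁻¹ * ∑ i, Real.exp (lam * ‖(Φ.flow s z i).2‖ ^ 2)) ∂ν
      ≤ ∫⁻ s, ∑' K : ℕ, c K * ENNReal.ofReal (frac (K : ℝ) (Φ.flow s z)) ∂ν :=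
        lintegral_mono fun s => pp_ofReal_expAvg_le_tsum hlam (Φ.flow s z)
    _ = ∑' K : ℕ, ∫⁻ s, c K * ENNReal.ofReal (frac (K : ℝ) (Φ.flow s z)) ∂ν :=
        lintegral_tsum fun K => ((hfm K).const_mul _).aemeasurable
    _ = ∑' K : ℕ, c K * I K := tsum_congr fun K => lintegral_const_mul _ (hfm K)
    _ = (∑ K ∈ Finset.range M, c K * I K) + ∑' j : ℕ, c (j + M) * I (j + M) :=
        (Summable.sum_add_tsum_nat_add' (f := fun K => c K * I K) ENNReal.summable).symm

/-! ## The Markov step with sure bottom-level control off the occupation events -/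

-- adapted from …FibrePartOnePrimeA.lean (`partOnePrime_markov_step`)
/-- **Markov step (one particle number).**  For a hard-sphere flow `Φ` of `N + 1` spheres, a law `P` carried by its
good set, `λ ≥ 0`, `t > 0`, `C ≥ 0`, a level cut `M`, nonnegative OCCUPATION thresholds `τ_K` with
`∑_{K<M} e^{λ(K+1)} τ_K ≤ tC + 1/2`, and weighted far occupations `e^{λ(j+M+1)} E_P ∫₀ᵗ frac_{j+M}(Φ_s ·) ds ≤ B ρ^j`
(`0 ≤ ρ < 1`):
`P{tC + 1 < ∫₀ᵗ (N+1)⁻¹∑ᵢ e^{λ|vᵢ(s)|²} ds} ≤ ∑_{K<M} P{τ_K < occ_K} + 2B/(1 − ρ)`,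
`occ_K = (∫⁻₀ᵗ frac_K(Φ_s ·) ds).toReal` (off the occupation events the bulk is sure; Markov on the far part). -/
theorem occupation_markov_step {N : ℕ} {ε : ℝ} (Φ : HardSphereFlow (Torus.geometry (Fin 3)) ε (N + 1))
    (P : Measure (Cfg N)) (hP : P Φ.goodᶜ = 0) {lam t C B ρ : ℝ} (M : ℕ) (τ : ℕ → ℝ) (hlam : 0 ≤ lam)
    (ht : 0 < t) (hC0 : 0 ≤ C) (hB : 0 ≤ B) (hρ : 0 ≤ ρ) (hρ1 : ρ < 1) (hτ : ∀ K, 0 ≤ τ K)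
    (hC : ∑ K ∈ Finset.range M, Real.exp (lam * ((K : ℝ) + 1)) * τ K ≤ t * C + 1 / 2)
    (hfar : ∀ j : ℕ, ENNReal.ofReal (Real.exp (lam * (((j + M : ℕ) : ℝ) + 1))) *
      ∫⁻ z, (∫⁻ s in Icc 0 t, ENNReal.ofReal (frac ((j + M : ℕ) : ℝ) (Φ.flow s z))) ∂P ≤
        ENNReal.ofReal (B * ρ ^ j)) :
    P {z | t * C + 1 < ∫ s in Icc 0 t, ((N + 1 : ℕ) : ℝ)⁻¹ * ∑ i, Real.exp (lam * ‖(Φ.flow s z i).2‖ ^ 2)} ≤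
      (∑ K ∈ Finset.range M,
          P {z | τ K < (∫⁻ s in Icc 0 t, ENNReal.ofReal (frac (K : ℝ) (Φ.flow s z))).toReal}) +
        ENNReal.ofReal (2 * (B / (1 - ρ))) := by
  set ν : Measure ℝ := volume.restrict (Icc 0 t) with hν
  -- the observables
  set c : ℕ → ℝ≥0∞ := fun K => ENNReal.ofReal (Real.exp (lam * ((K : ℝ) + 1))) with hc
  set G : Cfg N → ℝ := fun w => ((N + 1 : ℕ) : ℝ)⁻¹ * ∑ i, Real.exp (lam * ‖(w i).2‖ ^ 2) with hG
  have hGm : Measurable G :=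
    measurable_const.mul (Finset.measurable_sum _ fun i _ =>
      (measurable_pi_apply i).snd.norm.pow_const 2 |>.const_mul lam |>.exp)
  have hG0 : ∀ w, 0 ≤ G w := fun w =>
    mul_nonneg (by positivity) (Finset.sum_nonneg fun i _ => (Real.exp_pos _).le)
  set I : ℕ → Cfg N → ℝ≥0∞ := fun K z => ∫⁻ s, ENNReal.ofReal (frac (K : ℝ) (Φ.flow s z)) ∂ν with hI
  set R : Cfg N → ℝ≥0∞ := fun z => ∑' j : ℕ, c (j + M) * I (j + M) z with hR
  set Bad : ℕ → Set (Cfg N) := fun K => {z | τ K < (I K z).toReal} with hBad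
  -- the deterministic part
  set D : ℝ≥0∞ := ∑ K ∈ Finset.range M, c K * ENNReal.ofReal (τ K) with hD
  have hDeq : D = ENNReal.ofReal (∑ K ∈ Finset.range M, Real.exp (lam * ((K : ℝ) + 1)) * τ K) := by
    rw [hD, ENNReal.ofReal_sum_of_nonneg (fun K _ => mul_nonneg (Real.exp_pos _).le (hτ K))]
    refine Finset.sum_congr rfl fun K _ => ?_
    rw [ENNReal.ofReal_mul (Real.exp_pos _).le]
  have hDle : D ≤ ENNReal.ofReal (t * C) + ENNReal.ofReal (1 / 2) := by
    rw [hDeq, ← ENNReal.ofReal_add (mul_nonneg ht.le hC0) (by norm_num)]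
    exact ENNReal.ofReal_le_ofReal hC
  -- (1) on the good set and off the occupation events, the bad event forces `1/2 ≤ R`
  have hincl : {z | t * C + 1 < ∫ s in Icc 0 t, G (Φ.flow s z)} ⊆
      (Φ.goodᶜ ∪ ⋃ K ∈ Finset.range M, Bad K) ∪ {z | ENNReal.ofReal (1 / 2) ≤ R z} := by
    intro z hz1
    by_cases hz : z ∈ Φ.good
    swap
    · exact Or.inl (Or.inl hz)
    by_cases hbad : ∃ K ∈ Finset.range M, z ∈ Bad K
    · obtain ⟨K, hK, hzK⟩ := hbad
      exact Or.inl (Or.inr (mem_iUnion₂.2 ⟨K, hK, hzK⟩))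
    push Not at hbad
    right
    have hz1' : t * C + 1 < ∫ s, G (Φ.flow s z) ∂ν := hz1
    change ENNReal.ofReal (1 / 2) ≤ R z
    have horb : Measurable fun s => Φ.flow s z := (Φ.isTrajectory z hz).measurable_torus
    have hbdd : ∀ s, G (Φ.flow s z) ≤ Real.exp (lam * (2 * configEnergy z)) := fun s =>
      Φ.configEnergy_flow hz s ▸ AprioriBoundsNegative.expAvg_le_exp_lam_energy (N := N) hlam (Φ.flow s z)
    have hGi : Integrable (fun s => G (Φ.flow s z)) ν := by
      refine Measure.integrableOn_of_bounded (M := Real.exp (lam * (2 * configEnergy z)))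
        measure_Icc_lt_top.ne (hGm.comp horb).aestronglyMeasurable (ae_of_all _ fun s => ?_)
      rw [Real.norm_eq_abs, abs_of_nonneg (hG0 _)]
      exact hbdd s
    have hX : ENNReal.ofReal (∫ s, G (Φ.flow s z) ∂ν) = ∫⁻ s, ENNReal.ofReal (G (Φ.flow s z)) ∂ν :=
      ofReal_integral_eq_lintegral_ofReal hGi (ae_of_all _ fun s => hG0 _)
    have hlt : ENNReal.ofReal (t * C) + ENNReal.ofReal (1 / 2) + ENNReal.ofReal (1 / 2) <
        ∫⁻ s, ENNReal.ofReal (G (Φ.flow s z)) ∂ν := by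
      rw [← hX, ← ENNReal.ofReal_add (mul_nonneg ht.le hC0) (by norm_num),
        ← ENNReal.ofReal_add (by positivity) (by norm_num), ENNReal.ofReal_lt_ofReal_iff']
      have : 0 ≤ t * C := mul_nonneg ht.le hC0
      exact ⟨by linarith, by linarith⟩
    -- the bulk occupations are below their thresholds off the occupation events
    have hIK : ∀ K ∈ Finset.range M, c K * I K z ≤ c K * ENNReal.ofReal (τ K) := by
      intro K hK
      refine mul_le_mul' le_rfl ?_
      have hfin : I K z ≠ ⊤ := by
        refine ne_top_of_le_ne_top (b := ∫⁻ _s, (1 : ℝ≥0∞) ∂ν) ?_ (lintegral_mono fun s => ?_)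
        · rw [lintegral_const, hν, Measure.restrict_apply_univ, Real.volume_Icc, one_mul]
          exact ENNReal.ofReal_ne_top
        · calc ENNReal.ofReal (frac (K : ℝ) (Φ.flow s z)) ≤ ENNReal.ofReal 1 :=
              ENNReal.ofReal_le_ofReal (frac_mem_Icc _ _).2
            _ = 1 := ENNReal.ofReal_one
      have hle : (I K z).toReal ≤ τ K := not_lt.1 (hbad K hK)
      rw [← ENNReal.ofReal_toReal hfin]
      exact ENNReal.ofReal_le_ofReal hle
    have hle : ∫⁻ s, ENNReal.ofReal (G (Φ.flow s z)) ∂ν ≤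
        ENNReal.ofReal (t * C) + ENNReal.ofReal (1 / 2) + R z :=
      calc ∫⁻ s, ENNReal.ofReal (G (Φ.flow s z)) ∂ν
          ≤ (∑ K ∈ Finset.range M, c K * I K z) + R z := occ_lintegral_orbit_expAvg_le Φ hz hlam t M
        _ ≤ D + R z := add_le_add (Finset.sum_le_sum hIK) le_rfl
        _ ≤ ENNReal.ofReal (t * C) + ENNReal.ofReal (1 / 2) + R z := add_le_add hDle le_rfl
    exact (lt_of_add_lt_add_left (hlt.trans_le hle)).le
  -- (2) measurability along the flow (Tonelli on `good × [0,t]`)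
  have hIm : ∀ K, AEMeasurable (I K) P := fun K =>
    (aemeasurable_comp_flow_prod₂ Φ ((measurable_frac (K : ℝ)).ennreal_ofReal.comp measurable_fst) hP
      ν).lintegral_prod_right'
  have hRm : AEMeasurable R P := by
    have h : ∀ j, AEMeasurable (fun z => c (j + M) * I (j + M) z) P := fun j => (hIm (j + M)).const_mul _
    change AEMeasurable (fun z => ∑' j : ℕ, c (j + M) * I (j + M) z) P
    simp_rw [ENNReal.tsum_eq_iSup_sum]
    exact AEMeasurable.iSup fun s => Finset.aemeasurable_fun_sum s fun j _ => h j
  -- (3) the expectation of `R` (Tonelli and the far-level hypothesis)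
  have hER : ∫⁻ z, R z ∂P = ∑' j : ℕ, c (j + M) * ∫⁻ z, I (j + M) z ∂P := by
    change ∫⁻ z, ∑' j : ℕ, c (j + M) * I (j + M) z ∂P = _
    rw [lintegral_tsum (fun j => (hIm (j + M)).const_mul _)]
    exact tsum_congr fun j => lintegral_const_mul'' _ (hIm (j + M))
  have hER2 : ∑' j : ℕ, c (j + M) * ∫⁻ z, I (j + M) z ∂P ≤ ENNReal.ofReal (B / (1 - ρ)) := by
    calc ∑' j : ℕ, c (j + M) * ∫⁻ z, I (j + M) z ∂P ≤ ∑' j : ℕ, ENNReal.ofReal B * ENNReal.ofReal ρ ^ j := by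
          refine ENNReal.tsum_le_tsum fun j => ?_
          rw [← ENNReal.ofReal_pow hρ, ← ENNReal.ofReal_mul hB]
          exact hfar j
      _ = ENNReal.ofReal B * (1 - ENNReal.ofReal ρ)⁻¹ := by rw [ENNReal.tsum_mul_left, ENNReal.tsum_geometric]
      _ = ENNReal.ofReal (B / (1 - ρ)) := by
          rw [← ENNReal.ofReal_one, ← ENNReal.ofReal_sub _ hρ, ← ENNReal.ofReal_inv_of_pos (sub_pos.2 hρ1),
            ← ENNReal.ofReal_mul hB, div_eq_mul_inv]
  -- (4) Markov on the far part
  have hhalf0 : ENNReal.ofReal (1 / 2) ≠ 0 := (ENNReal.ofReal_pos.2 one_half_pos).ne'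
  have hMarkov : P {z | ENNReal.ofReal (1 / 2) ≤ R z} ≤ ENNReal.ofReal (2 * (B / (1 - ρ))) := by
    calc P {z | ENNReal.ofReal (1 / 2) ≤ R z}
        ≤ (∫⁻ z, R z ∂P) / ENNReal.ofReal (1 / 2) := meas_ge_le_lintegral_div hRm hhalf0 ENNReal.ofReal_ne_top
      _ ≤ ENNReal.ofReal (B / (1 - ρ)) / ENNReal.ofReal (1 / 2) := by
          rw [hER]
          exact ENNReal.div_le_div_right hER2 _
      _ = ENNReal.ofReal (2 * (B / (1 - ρ))) := by
          rw [← ENNReal.ofReal_div_of_pos one_half_pos]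
          ring_nf
  -- (5) assembly
  calc P {z | t * C + 1 < ∫ s in Icc 0 t, G (Φ.flow s z)}
      ≤ P ((Φ.goodᶜ ∪ ⋃ K ∈ Finset.range M, Bad K) ∪ {z | ENNReal.ofReal (1 / 2) ≤ R z}) :=
        measure_mono hincl
    _ ≤ P (Φ.goodᶜ ∪ ⋃ K ∈ Finset.range M, Bad K) + P {z | ENNReal.ofReal (1 / 2) ≤ R z} :=
        measure_union_le _ _
    _ ≤ (P Φ.goodᶜ + P (⋃ K ∈ Finset.range M, Bad K)) + P {z | ENNReal.ofReal (1 / 2) ≤ R z} :=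
        add_le_add (measure_union_le _ _) le_rfl
    _ ≤ (0 + ∑ K ∈ Finset.range M, P (Bad K)) + ENNReal.ofReal (2 * (B / (1 - ρ))) :=
        add_le_add (add_le_add hP.le (measure_biUnion_finset_le _ _)) hMarkov
    _ = _ := by rw [zero_add]

/-! ## The bound at one particle number -/

-- adapted from …FibrePartOnePrime.lean (`partOnePrime_bound_at`)
/-- **The bound at one (large) particle number.**  For one flow `Φ` of `N + 1` spheres (any profiles and `σ`: only
`P_N(goodᶜ) = 0` is used, not normalisation), a dialled `λ > 0` (`λ < 1/(2Θ)`, `λ < 1/(2Θ')`), a level cut `M`, a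
slack `η ≥ 0` with `η∑_{K<M}e^{λ(K+1)} ≤ 1/2` and the far-tail bound at `N` (all levels, constants `Θ', A'`):
`P_N{t·C_λ + 1 < ∫₀ᵗ ∫ e^{λ|v|²} dμ_{Φ_s z} ds} ≤ ∑_{K<M} P_N{tAe^{−K/(2Θ)} + η < occ_K} + 2tA'⁺e^{λ}ρ^M/(1 − ρ)`,
`C_λ = A⁺e^{λ}/(1 − e^{−(1/(2Θ)−λ)})`, `ρ = e^{−(1/(2Θ')−λ)}` (`occupation_markov_step` with `τ_K = tA⁺e^{−K/(2Θ)} + η`,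
`B = tA'⁺e^{λ}ρ^M`, and monotonicity `A ≤ A⁺` of the occupation events). -/
theorem occupation_bound_at {σ : ℝ} {a₀ θ₀ : T3 → ℝ} {u₀ : T3 → V3}
    {N : ℕ} (Φ : HardSphereFlow (Torus.geometry (Fin 3)) (hsDiameter σ N) (N + 1))
    {t lam Θ Θ' A A' η : ℝ} (ht : 0 < t) (hlam : 0 < lam)
    (hδ₁ : 0 < 1 / (2 * Θ) - lam) (hδ₂ : 0 < 1 / (2 * Θ') - lam) (M : ℕ) (hη : 0 ≤ η)
    (hfar : ∀ K : ℝ,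
      ∫⁻ z, (∫⁻ s in Icc 0 t, ENNReal.ofReal (frac K (Φ.flow s z))) ∂(localGibbsLaw σ a₀ u₀ θ₀ N Φ) ≤
        ENNReal.ofReal (t * A' * Real.exp (-(K / (2 * Θ')))))
    (hhalf : η * ∑ K ∈ Finset.range M, Real.exp (lam * ((K : ℝ) + 1)) ≤ 1 / 2) :
    localGibbsLaw σ a₀ u₀ θ₀ N Φ {z | t * (max A 0 * (Real.exp lam / (1 - Real.exp (-(1 / (2 * Θ) - lam))))) + 1 <
        ∫ s in Icc 0 t, ∫ y, Real.exp (lam * ‖y.2‖ ^ 2) ∂(empiricalMeasure (Φ.flow s z))} ≤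
      (∑ K ∈ Finset.range M, localGibbsLaw σ a₀ u₀ θ₀ N Φ
          {z | t * A * Real.exp (-((K : ℝ) / (2 * Θ))) + η <
            (∫⁻ s in Icc 0 t, ENNReal.ofReal (frac (K : ℝ) (Φ.flow s z))).toReal}) +
      ENNReal.ofReal (2 * (t * max A' 0 * Real.exp lam / (1 - Real.exp (-(1 / (2 * Θ') - lam))) *
          Real.exp (-(1 / (2 * Θ') - lam)) ^ M)) := by
  have hAp : A ≤ max A 0 := le_max_left _ _
  have hAp0 : 0 ≤ max A 0 := le_max_right _ _
  have hAp' : A' ≤ max A' 0 := le_max_left _ _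
  have hAp0' : 0 ≤ max A' 0 := le_max_right _ _
  set P : Measure (Cfg N) := localGibbsLaw σ a₀ u₀ θ₀ N Φ with hPdef
  have hgood0 : P Φ.goodᶜ = 0 := by
    rw [hPdef, localGibbsLaw_eq]
    exact (localGibbsMeasure_absolutelyContinuous σ _ _ _ N Φ) Φ.measure_compl_good
  set S₁ : ℝ := ∑ K ∈ Finset.range M, Real.exp (lam * ((K : ℝ) + 1)) with hS₁
  set δ' : ℝ := 1 / (2 * Θ') - lam with hδ'_def
  set ρ : ℝ := Real.exp (-δ') with hρ_def
  have hρ0 : 0 < ρ := Real.exp_pos _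
  have hρ1 : ρ < 1 := Real.exp_lt_one_iff.2 (by linarith)
  set B : ℝ := t * max A' 0 * Real.exp lam * ρ ^ M with hB
  have hB0 : 0 ≤ B := by positivity
  set Cl : ℝ := max A 0 * (Real.exp lam / (1 - Real.exp (-(1 / (2 * Θ) - lam)))) with hCl
  have h1q : 0 < 1 - Real.exp (-(1 / (2 * Θ) - lam)) := sub_pos.2 (Real.exp_lt_one_iff.2 (by linarith))
  have hCl0 : 0 ≤ Cl := by positivity
  set τ : ℕ → ℝ := fun K => t * max A 0 * Real.exp (-((K : ℝ) / (2 * Θ))) + η with hτ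
  have hτ0 : ∀ K, 0 ≤ τ K := fun K => by positivity
  -- (a) the deterministic bulk sum
  have hC : ∑ K ∈ Finset.range M, Real.exp (lam * ((K : ℝ) + 1)) * τ K ≤ t * Cl + 1 / 2 := by
    have hsplit : ∑ K ∈ Finset.range M, Real.exp (lam * ((K : ℝ) + 1)) * τ K =
        t * max A 0 * ∑ K ∈ Finset.range M, Real.exp (lam * ((K : ℝ) + 1)) *
          Real.exp (-((K : ℝ) / (2 * Θ))) + η * S₁ := by
      rw [hS₁, Finset.mul_sum, Finset.mul_sum, ← Finset.sum_add_distrib]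
      refine Finset.sum_congr rfl fun K _ => ?_
      simp only [hτ]
      ring
    have hgeo : t * max A 0 * ∑ K ∈ Finset.range M, Real.exp (lam * ((K : ℝ) + 1)) *
        Real.exp (-((K : ℝ) / (2 * Θ))) ≤ t * Cl := by
      have h := mul_le_mul_of_nonneg_left (pp_sum_range_exp_mul_exp_neg_le hδ₁ M) (mul_nonneg ht.le hAp0)
      calc _ ≤ t * max A 0 * (Real.exp lam / (1 - Real.exp (-(1 / (2 * Θ) - lam)))) := h
        _ = t * Cl := by rw [hCl]; ring
    rw [hsplit]
    exact add_le_add hgeo hhalf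
  -- (b) the far levels
  have hfar' : ∀ j : ℕ, ENNReal.ofReal (Real.exp (lam * (((j + M : ℕ) : ℝ) + 1))) *
      ∫⁻ z, (∫⁻ s in Icc 0 t, ENNReal.ofReal (frac ((j + M : ℕ) : ℝ) (Φ.flow s z))) ∂P ≤
      ENNReal.ofReal (B * ρ ^ j) := by
    intro j
    have h := hfar (((j + M : ℕ) : ℝ))
    set x : ℝ := ((j + M : ℕ) : ℝ) with hx
    have hmono : t * A' * Real.exp (-(x / (2 * Θ'))) ≤ t * max A' 0 * Real.exp (-(x / (2 * Θ'))) :=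
      mul_le_mul_of_nonneg_right (mul_le_mul_of_nonneg_left hAp' ht.le) (Real.exp_pos _).le
    have hxe : x = (j : ℝ) + (M : ℝ) := by rw [hx]; push_cast; ring
    have ex : Real.exp (lam * (x + 1)) * Real.exp (-(x / (2 * Θ'))) = Real.exp lam * ρ ^ M * ρ ^ j := by
      rw [hρ_def, ← Real.exp_nat_mul, ← Real.exp_nat_mul, ← Real.exp_add, ← Real.exp_add, ← Real.exp_add, hxe,
        hδ'_def]
      congr 1
      ring
    have halg : Real.exp (lam * (x + 1)) * (t * max A' 0 * Real.exp (-(x / (2 * Θ')))) = B * ρ ^ j := by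
      rw [hB]; linear_combination (t * max A' 0) * ex
    calc ENNReal.ofReal (Real.exp (lam * (x + 1))) *
          ∫⁻ z, (∫⁻ s in Icc 0 t, ENNReal.ofReal (frac x (Φ.flow s z))) ∂P
        ≤ ENNReal.ofReal (Real.exp (lam * (x + 1))) *
            ENNReal.ofReal (t * max A' 0 * Real.exp (-(x / (2 * Θ')))) :=
          mul_le_mul' le_rfl (h.trans (ENNReal.ofReal_le_ofReal hmono))
      _ = ENNReal.ofReal (B * ρ ^ j) := by rw [← ENNReal.ofReal_mul (Real.exp_pos _).le, halg]
  -- (c) the Markov step with sure bottom-level control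
  have hstep := occupation_markov_step Φ P hgood0 M τ hlam.le ht hCl0 hB0 hρ0.le hρ1 hτ0 hC hfar'
  -- (d) monotonicity of the occupation events in `A ≤ A⁺`
  have hBad : ∀ K ∈ Finset.range M,
      P {z | τ K < (∫⁻ s in Icc 0 t, ENNReal.ofReal (frac (K : ℝ) (Φ.flow s z))).toReal} ≤
        P {z | t * A * Real.exp (-((K : ℝ) / (2 * Θ))) + η <
          (∫⁻ s in Icc 0 t, ENNReal.ofReal (frac (K : ℝ) (Φ.flow s z))).toReal} := by
    intro K _
    refine measure_mono fun z hz => ?_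
    have he : 0 ≤ Real.exp (-((K : ℝ) / (2 * Θ))) := (Real.exp_pos _).le
    have hle : t * A * Real.exp (-((K : ℝ) / (2 * Θ))) + η ≤ τ K := by
      show t * A * Real.exp (-((K : ℝ) / (2 * Θ))) + η ≤ t * max A 0 * Real.exp (-((K : ℝ) / (2 * Θ))) + η
      exact add_le_add (mul_le_mul_of_nonneg_right (mul_le_mul_of_nonneg_left hAp ht.le) he) le_rfl
    exact hle.trans_lt hz
  have hsub : {z : Cfg N | t * Cl + 1 < ∫ s in Icc 0 t, ∫ y, Real.exp (lam * ‖y.2‖ ^ 2)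
      ∂(empiricalMeasure (Φ.flow s z))} ⊆ {z | t * Cl + 1 < ∫ s in Icc 0 t, ((N + 1 : ℕ) : ℝ)⁻¹ *
      ∑ i, Real.exp (lam * ‖(Φ.flow s z i).2‖ ^ 2)} := by
    intro z hz
    simp only [mem_setOf_eq, integral_empiricalMeasure] at hz ⊢
    exact hz
  have e : B / (1 - ρ) = t * max A' 0 * Real.exp lam / (1 - ρ) * ρ ^ M := by rw [hB]; ring
  rw [e] at hstep
  exact (measure_mono hsub).trans (hstep.trans (add_le_add (Finset.sum_le_sum hBad) le_rfl))

/-! ## The stub -/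

/-- STUB `stub_partOne_of_occupation` of the line `meso-chebyshev-window` (PROVED; byte-identical to stub 5 of
`Lines/tail_occupation_variance.lean` and of `Lines/local_units_on_the_kinetic_box.lean`): **for `0 < σ ≤ 1/2`,
nice profiles and `t > 0`, the in-probability Gaussian profile of the time-integrated occupations (`Θ, A`: for all
`K` and `η > 0`, `P_N{tAe^{−K/(2Θ)} + η < occ_K} → 0`) and `FarTailAllAt` give `PartOneAt`** — component (i) of the
crux verbatim, with the dialled `λ` of `pp_exists_dial` and the fixed threshold `C := t·A⁺e^{λ}/(1 − e^{−(1/(2Θ)−λ)}) + 1`;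
for every `η > 0` a fixed level cut `M` (far part by Markov) and the slack `η₁ = 1/(2S₁ + 2)` at the `M` bottom levels
(occupation events, in probability) make `P_N(bad) ≤ η` eventually. -/
theorem stub_partOne_of_occupation :
    ∀ (σ : ℝ) (a₀ θ₀ : T3 → ℝ) (u₀ : T3 → V3)
      (Φ : (N : ℕ) → HardSphereFlow (Torus.geometry (Fin 3)) (hsDiameter σ N) (N + 1)) (t : ℝ),
      0 < σ → σ ≤ 1 / 2 → NiceProfiles a₀ θ₀ u₀ → 0 < t →
      (∃ Θ A : ℝ, 0 < Θ ∧ ∀ K : ℝ, ∀ η : ℝ, 0 < η →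
          Tendsto (fun N : ℕ => localGibbsLaw σ a₀ u₀ θ₀ N (Φ N)
            {z | t * A * Real.exp (-(K / (2 * Θ))) + η <
              (∫⁻ s in Icc 0 t, ENNReal.ofReal (frac K ((Φ N).flow s z))).toReal}) atTop (𝓝 0)) →
      FarTailAllAt σ a₀ θ₀ u₀ Φ t → PartOneAt σ a₀ θ₀ u₀ Φ t := by
  intro σ a₀ θ₀ u₀ Φ t _hσ _hσ2 _hP ht hOcc hFar
  obtain ⟨Θ, A, hΘ, hocc⟩ := hOcc
  obtain ⟨Θ', A', hΘ', N₀', hfar⟩ := hFar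
  obtain ⟨lam, hlam, hδ₁, hδ₂⟩ := pp_exists_dial hΘ hΘ'
  set ρ : ℝ := Real.exp (-(1 / (2 * Θ') - lam)) with hρ_def
  have hρ0 : 0 < ρ := Real.exp_pos _
  have hρ1 : ρ < 1 := Real.exp_lt_one_iff.2 (by linarith)
  have h1ρ : 0 < 1 - ρ := sub_pos.2 hρ1
  set Cl : ℝ := max A 0 * (Real.exp lam / (1 - Real.exp (-(1 / (2 * Θ) - lam)))) with hCl
  set c₂ : ℝ := t * max A' 0 * Real.exp lam / (1 - ρ) with hc₂
  have hAp0' : 0 ≤ max A' 0 := le_max_right _ _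
  have hc₂0 : 0 ≤ c₂ := by positivity
  refine ⟨lam, t * Cl + 1, hlam, ?_⟩
  -- for every `η > 0`, eventually `P_N(bad) ≤ η`
  have hmain : ∀ η : ℝ, 0 < η → ∀ᶠ N in atTop, localGibbsLaw σ a₀ u₀ θ₀ N (Φ N)
      {z | t * Cl + 1 < ∫ s in Icc 0 t, ∫ y, Real.exp (lam * ‖y.2‖ ^ 2) ∂(empiricalMeasure ((Φ N).flow s z))} ≤
      ENNReal.ofReal η := by
    intro η hη
    -- the fixed level cut `M`: the far part is `< η/4`
    have hT : Tendsto (fun M : ℕ => c₂ * ρ ^ M) atTop (𝓝 0) := by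
      simpa using (tendsto_pow_atTop_nhds_zero_of_lt_one hρ0.le hρ1).const_mul c₂
    obtain ⟨M, hM⟩ := ((tendsto_order.1 hT).2 (η / 4) (by positivity)).exists
    set S₁ : ℝ := ∑ K ∈ Finset.range M, Real.exp (lam * ((K : ℝ) + 1)) with hS₁
    have hS₁0 : 0 ≤ S₁ := Finset.sum_nonneg fun K _ => (Real.exp_pos _).le
    -- the slack `η₁` at the bottom levels: `η₁ S₁ ≤ 1/2`
    set η₁ : ℝ := 1 / (2 * S₁ + 2) with hη₁_def
    have hη₁0 : 0 < η₁ := by positivity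
    have hhalf : η₁ * S₁ ≤ 1 / 2 := by
      have e : η₁ * S₁ = S₁ / (2 * S₁ + 2) := by rw [hη₁_def]; ring
      rw [e, div_le_iff₀ (by positivity)]
      nlinarith
    -- the `M` bottom occupation events have total probability `→ 0` (H1 at each fixed level)
    have hbot : Tendsto (fun N : ℕ => ∑ K ∈ Finset.range M, localGibbsLaw σ a₀ u₀ θ₀ N (Φ N)
        {z | t * A * Real.exp (-((K : ℝ) / (2 * Θ))) + η₁ <
          (∫⁻ s in Icc 0 t, ENNReal.ofReal (frac (K : ℝ) ((Φ N).flow s z))).toReal}) atTop (𝓝 0) := by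
      have h := tendsto_finsetSum (Finset.range M) (fun K _ => hocc (K : ℝ) η₁ hη₁0)
      rwa [Finset.sum_const_zero] at h
    have hbot' := ENNReal.tendsto_nhds_zero.1 hbot (ENNReal.ofReal (η / 2)) (ENNReal.ofReal_pos.2 (by positivity))
    filter_upwards [hbot', eventually_ge_atTop N₀'] with N hN hN'
    have h := occupation_bound_at (A := A) (Φ N) ht hlam hδ₁ hδ₂ M hη₁0.le (hfar N hN') hhalf
    refine h.trans ?_
    have h2 : c₂ * ρ ^ M < η / 4 := hM
    have h3 : t * max A' 0 * Real.exp lam / (1 - ρ) * ρ ^ M = c₂ * ρ ^ M := by rw [hc₂]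
    rw [h3]
    calc _ ≤ ENNReal.ofReal (η / 2) + ENNReal.ofReal (2 * (c₂ * ρ ^ M)) := add_le_add hN le_rfl
      _ = ENNReal.ofReal (η / 2 + 2 * (c₂ * ρ ^ M)) := (ENNReal.ofReal_add (by positivity) (by positivity)).symm
      _ ≤ ENNReal.ofReal η := ENNReal.ofReal_le_ofReal (by linarith)
  -- conclusion
  refine ENNReal.tendsto_nhds_zero.2 fun e he => ?_
  rcases eq_or_ne e ⊤ with rfl | hne
  · exact Eventually.of_forall fun N => le_top
  · have hη : 0 < e.toReal := ENNReal.toReal_pos he.ne' hne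
    filter_upwards [hmain e.toReal hη] with N hN
    rwa [ENNReal.ofReal_toReal hne] at hN

end Summit.AtomisticToContinuum.HydrodynamicLimit.Theorems.MesoChebyshevWindow

end
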